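import Summits.AtomisticToContinuum.Crystallization.Theorems.FrustratedLawDichotomyCellArithWitness

/-!
# FrustratedLawDichotomy · crux `AperiodicFrustratedLawGap` (stmt-AtomisticToContinuum-27623) — CELL-ARITH, the ALL-INTEGER per-pair
# NASH kernel for TIER-K cells (decomp-a2c hand-1 g53; K-BUDGET ALARM l.94xx: the per-label NASH block is ≈ 2·|MI|·|B(L_N)| ≈ 6e5 pair
# terms per cell; with `ℚ` readings ≈ 4.4 ms/term in the kernel (hours), with pure `ℤ` ≈ 0.04 ms/op (minutes))

Per pair NOTHING is rounded and no rational is touched: the class readings `PL ≤ S·ψ(t) ≤ PH`, `P1L ≤ S·ψ′(t) ≤ P1H` (once per bond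
class, `…CellArithLJ`), the INTEGER class vector `z` (label coordinates `a = (hn/hd)·z`), the INTEGER multiplier numerators `w`
(`ω = w/D`), and the rational `ε = en/ed` of the near-identity box `|G − 1| ≤ ε` give the coordinate box of
`Σ·(linLab G a ω) i`, `Σ := S·D·ed·hd²`, as EXACT integers:

* §1 `izLo/izHi` (reading interval × integer of either sign, exact), `dotZ`, `l1Z`;
* §2 ★ `gram_int_mem` — the bilinear near-identity enclosure `ed·(z·w) − en·|z|₁|w|₁ ≤ ed·g(z, w) ≤ ed·(z·w) + en·|z|₁|w|₁` for integer vectors;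
* §3 two-scale four-corner products `pairLo_le₂/le_pairHi₂` (readings at scales `S` and `T` ⇒ scale `S·T`);
* §4 ★ `linLabILo/linLabIHi` + `linLabI_mem` — the per-pair coordinate box at scale `Σ`; ★ `leadILo/leadIHi` + `leadI_mem` — the leading term
  `ψ(g(a,a))·a i` of `nashVecLab` at the same scale.
The norm step per label is `…CellArithGram.norm_posL_le_of_gramHiZ2` at scale `Σ` (coordinate box `WL/WH := nashILo/nashIHi`).

* §5 ★ `nashILo/nashIHi` + `nashI_mem` — the box of `Σ·(nashVecLab …) i` over (252)'s near sets from INTEGER tables.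
The FLAT kernel form (six flat integer arguments per pair, `if`-branches, no `Fin 3` sums — measured ×2.4 faster in the kernel) is the
sequel `…CellArithNashIntFlat`.  Computable `def`s over `ℤ` only; imports `…CellArithWitness`; 0 sorry.  Tags: [folklore].
-/

namespace Summit.AtomisticToContinuum.Crystallization.Theorems.FrustratedLawDichotomyCellArithNashInt

open scoped BigOperators
open Summit.AtomisticToContinuum.Crystallization.Theorems.FrustratedLawDichotomyCoherentFloorAlgebra (psiT psiT1)
open Summit.AtomisticToContinuum.Crystallization.Theorems.FrustratedLawDichotomyCellEnclosures (mul_le_of_corners corners_le_mul)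
open Summit.AtomisticToContinuum.Crystallization.Theorems.FrustratedLawDichotomyCellMetric (gram linLab nashVecLab)
open Summit.AtomisticToContinuum.Crystallization.Theorems.FrustratedLawDichotomyCellArithGram (pairLo pairHi)

/-! ## §1 Integer helpers -/

/-- exact lower bound of `c·x` from a reading interval `XL ≤ T·x ≤ XH` and an INTEGER `c` of either sign (scale `T`). [folklore] -/
def izLo (XL XH c : ℤ) : ℤ := min (c * XL) (c * XH)

/-- exact upper bound of `c·x` from a reading interval and an integer `c` (scale `T`). [folklore] -/
def izHi (XL XH c : ℤ) : ℤ := max (c * XL) (c * XH)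

/-- integer dot product. [folklore] -/
def dotZ (z w : Fin 3 → ℤ) : ℤ := ∑ i, z i * w i

/-- integer `ℓ¹` norm. [folklore] -/
def l1Z (v : Fin 3 → ℤ) : ℤ := ∑ i, |v i|

/-- `izLo ≤ T·(c·x)`. [folklore] -/
theorem izLo_le {XL XH c : ℤ} {T x : ℝ} (h1 : (XL : ℝ) ≤ T * x) (h2 : T * x ≤ (XH : ℝ)) :
    ((izLo XL XH c : ℤ) : ℝ) ≤ T * ((c : ℝ) * x) := by
  unfold izLo; push_cast
  have e : T * ((c : ℝ) * x) = (c : ℝ) * (T * x) := by ring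
  rw [e]
  rcases le_total 0 (c : ℝ) with hc | hc
  · exact (min_le_left _ _).trans (mul_le_mul_of_nonneg_left h1 hc)
  · exact (min_le_right _ _).trans (mul_le_mul_of_nonpos_left h2 hc)

/-- `T·(c·x) ≤ izHi`. [folklore] -/
theorem le_izHi {XL XH c : ℤ} {T x : ℝ} (h1 : (XL : ℝ) ≤ T * x) (h2 : T * x ≤ (XH : ℝ)) :
    T * ((c : ℝ) * x) ≤ ((izHi XL XH c : ℤ) : ℝ) := by
  unfold izHi; push_cast
  have e : T * ((c : ℝ) * x) = (c : ℝ) * (T * x) := by ring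
  rw [e]
  rcases le_total 0 (c : ℝ) with hc | hc
  · exact (mul_le_mul_of_nonneg_left h2 hc).trans (le_max_right _ _)
  · exact (mul_le_mul_of_nonpos_left h1 hc).trans (le_max_left _ _)

/-! ## §2 The bilinear near-identity enclosure for integer vectors -/

section Bilinear

variable {G : Matrix (Fin 3) (Fin 3) ℝ} {ε : ℝ}

/-- `|g(v, u) − v·u| ≤ ε·|v|₁·|u|₁` on the near-identity box (real vectors). [folklore] -/
theorem abs_gram_sub_dot_le (hG : ∀ i j, |G i j - (if i = j then 1 else 0)| ≤ ε) (v u : Fin 3 → ℝ) :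
    |gram G v u - ∑ i, v i * u i| ≤ ε * ((∑ i, |v i|) * (∑ j, |u j|)) := by
  have e : gram G v u - ∑ i, v i * u i = ∑ i, ∑ j, (G i j - (if i = j then 1 else 0)) * (v i * u j) := by
    have h1 : ∑ i, v i * u i = ∑ i, ∑ j, (if i = j then (1 : ℝ) else 0) * (v i * u j) := by
      refine Finset.sum_congr rfl fun i _ => ?_
      rw [Finset.sum_eq_single i]
      · simp
      · intro j _ hji; simp [Ne.symm hji]
      · intro h; exact (h (Finset.mem_univ i)).elim
    unfold gram
    rw [h1, ← Finset.sum_sub_distrib]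
    refine Finset.sum_congr rfl fun i _ => ?_
    rw [← Finset.sum_sub_distrib]
    refine Finset.sum_congr rfl fun j _ => ?_
    ring
  rw [e, Finset.sum_mul_sum, Finset.mul_sum]
  refine (Finset.abs_sum_le_sum_abs _ _).trans (Finset.sum_le_sum fun i _ => ?_)
  rw [Finset.mul_sum]
  refine (Finset.abs_sum_le_sum_abs _ _).trans (Finset.sum_le_sum fun j _ => ?_)
  rw [abs_mul, abs_mul]
  have h := hG i j
  have := mul_le_mul_of_nonneg_right h (mul_nonneg (abs_nonneg (v i)) (abs_nonneg (u j)))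
  linarith

/-- ★ INTEGER FORM: `ε = en/ed`, `0 < ed` ⇒ `ed·(z·w) − en·|z|₁|w|₁ ≤ ed·g(z, w) ≤ ed·(z·w) + en·|z|₁|w|₁` for integer `z w`. [folklore] -/
theorem gram_int_mem (hG : ∀ i j, |G i j - (if i = j then 1 else 0)| ≤ ε) {en ed : ℤ} (hed : 0 < ed)
    (hε : ε = (en : ℝ) / (ed : ℝ)) (z w : Fin 3 → ℤ) :
    ((ed * dotZ z w - en * (l1Z z * l1Z w) : ℤ) : ℝ) ≤ (ed : ℝ) * gram G (fun i => (z i : ℝ)) (fun j => (w j : ℝ))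
      ∧ (ed : ℝ) * gram G (fun i => (z i : ℝ)) (fun j => (w j : ℝ)) ≤ ((ed * dotZ z w + en * (l1Z z * l1Z w) : ℤ) : ℝ) := by
  have h := abs_gram_sub_dot_le hG (fun i => (z i : ℝ)) (fun j => (w j : ℝ))
  have hed' : (0 : ℝ) < ed := by exact_mod_cast hed
  have e1 : (ed : ℝ) * (ε * ((∑ i, |(z i : ℝ)|) * ∑ j, |(w j : ℝ)|)) = (en : ℝ) * ((∑ i, |(z i : ℝ)|) * ∑ j, |(w j : ℝ)|) := by
    rw [hε]; field_simp
  obtain ⟨hl, hu⟩ := abs_le.1 h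
  unfold dotZ l1Z; push_cast
  constructor
  · have := mul_le_mul_of_nonneg_left hl hed'.le
    nlinarith [e1]
  · have := mul_le_mul_of_nonneg_left hu hed'.le
    nlinarith [e1]

end Bilinear

/-! ## §3 Two-scale four-corner products -/

/-- `pairLo aL aH bL bH ≤ (S·T)·(x·y)` from `aL ≤ S·x ≤ aH`, `bL ≤ T·y ≤ bH`. [folklore] -/
theorem pairLo_le₂ {aL aH bL bH : ℤ} {S T x y : ℝ} (ha1 : (aL : ℝ) ≤ S * x) (ha2 : S * x ≤ (aH : ℝ))
    (hb1 : (bL : ℝ) ≤ T * y) (hb2 : T * y ≤ (bH : ℝ)) : ((pairLo aL aH bL bH : ℤ) : ℝ) ≤ (S * T) * (x * y) := by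
  have W := corners_le_mul ha1 ha2 hb1 hb2
  have e : (S * T) * (x * y) = (S * x) * (T * y) := by ring
  rw [e]; unfold pairLo; push_cast; exact W

/-- `(S·T)·(x·y) ≤ pairHi aL aH bL bH`. [folklore] -/
theorem le_pairHi₂ {aL aH bL bH : ℤ} {S T x y : ℝ} (ha1 : (aL : ℝ) ≤ S * x) (ha2 : S * x ≤ (aH : ℝ))
    (hb1 : (bL : ℝ) ≤ T * y) (hb2 : T * y ≤ (bH : ℝ)) : (S * T) * (x * y) ≤ ((pairHi aL aH bL bH : ℤ) : ℝ) := by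
  have W := mul_le_of_corners ha1 ha2 hb1 hb2
  have e : (S * T) * (x * y) = (S * x) * (T * y) := by ring
  rw [e]; unfold pairHi; push_cast; exact W

/-! ## §4 The per-pair `linLab` box and the leading term, all integers at scale `Σ = S·D·ed·hd²` -/

/-- LOWER integer bound of `Σ·(linLab G a ω) i` (`a = (hn/hd)·z`, `ω = w/D`): term `ψ·ω_i` scaled by `ed·hd²`, term
`2·g(a,ω)·ψ′·a_i` through the corner product of `S·ψ′` and `ed·Γ`, `Γ = Σ G_ij z_i w_j`. [folklore] -/
def linLabILo (PL PH P1L P1H ed en hn hd : ℤ) (z w : Fin 3 → ℤ) (i : Fin 3) : ℤ :=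
  ed * hd ^ 2 * izLo PL PH (w i)
    + izLo (pairLo P1L P1H (ed * dotZ z w - en * (l1Z z * l1Z w)) (ed * dotZ z w + en * (l1Z z * l1Z w)))
        (pairHi P1L P1H (ed * dotZ z w - en * (l1Z z * l1Z w)) (ed * dotZ z w + en * (l1Z z * l1Z w))) (2 * hn ^ 2 * z i)

/-- UPPER integer bound of `Σ·(linLab G a ω) i`. [folklore] -/
def linLabIHi (PL PH P1L P1H ed en hn hd : ℤ) (z w : Fin 3 → ℤ) (i : Fin 3) : ℤ :=
  ed * hd ^ 2 * izHi PL PH (w i)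
    + izHi (pairLo P1L P1H (ed * dotZ z w - en * (l1Z z * l1Z w)) (ed * dotZ z w + en * (l1Z z * l1Z w)))
        (pairHi P1L P1H (ed * dotZ z w - en * (l1Z z * l1Z w)) (ed * dotZ z w + en * (l1Z z * l1Z w))) (2 * hn ^ 2 * z i)

/-- LOWER integer bound of `Σ·(ψ(g(a,a))·a) i`, the leading term of `nashVecLab`. [folklore] -/
def leadILo (PL PH D ed hn hd : ℤ) (z : Fin 3 → ℤ) (i : Fin 3) : ℤ := izLo PL PH (D * ed * hd * hn * z i)

/-- UPPER integer bound of `Σ·(ψ(g(a,a))·a) i`. [folklore] -/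
def leadIHi (PL PH D ed hn hd : ℤ) (z : Fin 3 → ℤ) (i : Fin 3) : ℤ := izHi PL PH (D * ed * hd * hn * z i)

section PerPair

variable {S D ed en hn hd PL PH P1L P1H : ℤ} {G : Matrix (Fin 3) (Fin 3) ℝ} {ε : ℝ} {z w : Fin 3 → ℤ}
  {a ω : Fin 3 → ℝ} {i : Fin 3}

/-- ★ THE PER-PAIR BOX: with `a = (hn/hd)·z`, `ω = w/D`, `ε = en/ed` (`0 < D, ed, hd`), class readings of `ψ`, `ψ′` at `t = g(a, a)`:
`linLabILo ≤ (S·D·ed·hd²)·(linLab G a ω) i ≤ linLabIHi`. [folklore] -/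
theorem linLabI_mem (hG : ∀ i j, |G i j - (if i = j then 1 else 0)| ≤ ε) (hε : ε = (en : ℝ) / (ed : ℝ)) (hed : 0 < ed)
    (hD : 0 < D) (hhd : 0 < hd) (ha : ∀ j, a j = (hn : ℝ) / (hd : ℝ) * (z j : ℝ)) (hω : ∀ j, ω j = (w j : ℝ) / (D : ℝ))
    (hPL : (PL : ℝ) ≤ S * psiT (gram G a a)) (hPH : S * psiT (gram G a a) ≤ (PH : ℝ))
    (hP1L : (P1L : ℝ) ≤ S * psiT1 (gram G a a)) (hP1H : S * psiT1 (gram G a a) ≤ (P1H : ℝ)) :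
    ((linLabILo PL PH P1L P1H ed en hn hd z w i : ℤ) : ℝ) ≤ ((S * D * ed * hd ^ 2 : ℤ) : ℝ) * linLab G a ω i
      ∧ ((S * D * ed * hd ^ 2 : ℤ) : ℝ) * linLab G a ω i ≤ ((linLabIHi PL PH P1L P1H ed en hn hd z w i : ℤ) : ℝ) := by
  have hD' : (0 : ℝ) < D := by exact_mod_cast hD
  have hhd' : (0 : ℝ) < hd := by exact_mod_cast hhd
  have hed' : (0 : ℝ) < ed := by exact_mod_cast hed
  -- the bilinear quantity Γ = Σ G_ij z_i w_j, read at scale ed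
  obtain ⟨g1, g2⟩ := gram_int_mem hG hed hε z w
  -- gram G a ω = (hn/hd)/D · Γ  (bilinearity, via the explicit sums)
  have eΓ : gram G a ω = (hn : ℝ) / hd / D * gram G (fun i => (z i : ℝ)) (fun j => (w j : ℝ)) := by
    unfold gram; rw [Finset.mul_sum]
    refine Finset.sum_congr rfl fun i _ => ?_
    rw [Finset.mul_sum]
    refine Finset.sum_congr rfl fun j _ => ?_
    rw [ha i, hω j]; field_simp
  -- corner product of (S ψ′) and (ed Γ): scale S·ed
  have cL := pairLo_le₂ hP1L hP1H g1 g2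
  have cH := le_pairHi₂ hP1L hP1H g1 g2
  -- term 2 = 2 g ψ′ a_i = (2 hn² z_i /(hd² D)) · (ψ′ Γ)·(hn-free)… assemble
  have t2L := izLo_le (c := 2 * hn ^ 2 * z i) cL cH
  have t2H := le_izHi (c := 2 * hn ^ 2 * z i) cL cH
  -- term 1 = ψ ω_i = ψ w_i / D: scale S·D exact
  have t1L := izLo_le (c := w i) hPL hPH
  have t1H := le_izHi (c := w i) hPL hPH
  -- the coordinate of linLab at scale Σ = S·D·ed·hd²
  have e : ((S * D * ed * hd ^ 2 : ℤ) : ℝ) * linLab G a ω i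
      = (ed : ℝ) * hd ^ 2 * (S * ((w i : ℝ) * psiT (gram G a a)))
        + (S * ed) * (((2 * hn ^ 2 * z i : ℤ) : ℝ) * (psiT1 (gram G a a) * gram G (fun i => (z i : ℝ)) (fun j => (w j : ℝ)))) := by
    simp only [linLab, Pi.add_apply, Pi.smul_apply, smul_eq_mul]
    rw [eΓ, ha i, hω i]; push_cast
    field_simp
  unfold linLabILo linLabIHi
  rw [e]
  have hk : (0 : ℝ) ≤ (ed : ℝ) * hd ^ 2 := by positivity
  have AL := mul_le_mul_of_nonneg_left t1L hk
  have AH := mul_le_mul_of_nonneg_left t1H hk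
  push_cast at AL AH t2L t2H ⊢
  constructor
  · linarith
  · linarith

/-- ★ THE LEADING TERM: `leadILo ≤ (S·D·ed·hd²)·(ψ(g(a,a))·a) i ≤ leadIHi` (exact integer scaling of the `ψ` reading). [folklore] -/
theorem leadI_mem (hhd : 0 < hd) (ha : ∀ j, a j = (hn : ℝ) / (hd : ℝ) * (z j : ℝ))
    (hPL : (PL : ℝ) ≤ S * psiT (gram G a a)) (hPH : S * psiT (gram G a a) ≤ (PH : ℝ)) :
    ((leadILo PL PH D ed hn hd z i : ℤ) : ℝ) ≤ ((S * D * ed * hd ^ 2 : ℤ) : ℝ) * (psiT (gram G a a) • a) i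
      ∧ ((S * D * ed * hd ^ 2 : ℤ) : ℝ) * (psiT (gram G a a) • a) i ≤ ((leadIHi PL PH D ed hn hd z i : ℤ) : ℝ) := by
  have hhd' : (0 : ℝ) < hd := by exact_mod_cast hhd
  have L := izLo_le (c := D * ed * hd * hn * z i) hPL hPH
  have H := le_izHi (c := D * ed * hd * hn * z i) hPL hPH
  have e : ((S * D * ed * hd ^ 2 : ℤ) : ℝ) * (psiT (gram G a a) • a) i
      = S * (((D * ed * hd * hn * z i : ℤ) : ℝ) * psiT (gram G a a)) := by
    simp only [Pi.smul_apply, smul_eq_mul]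
    rw [ha i]; push_cast
    field_simp
  unfold leadILo leadIHi
  rw [e]
  exact ⟨L, H⟩

end PerPair

/-! ## §5 The NASH box over (252)'s near sets from INTEGER tables (scale `Σ = S·D·ed·hd²`) -/

section Assembly

variable {ι : Type*} [DecidableEq ι]

/-- LOWER integer bound of `Σ·(nashVecLab G M MI a ω nb m) i` from integer label data `z w`, the leading-term readings `P0L P0H`, and
per-pair class-reading TABLES (`PL PH P1L P1H` for own-multiplier pairs `m'`, primed for neighbour pairs `x`). [folklore] -/
def nashILo (M MI : Finset ι) (nb : ι → Finset ι) (m : ι) (i : Fin 3) (z w : ι → Fin 3 → ℤ) (D ed en hn hd P0L P0H : ℤ)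
    (PL PH P1L P1H PL' PH' P1L' P1H' : ι → ℤ) : ℤ :=
  leadILo P0L P0H D ed hn hd (z m) i
    - (if m ∈ MI then ∑ m' ∈ (M.erase m).filter (fun m' => m' ∈ nb m),
        linLabIHi (PL m') (PH m') (P1L m') (P1H m') ed en hn hd (z m - z m') (w m) i else 0)
    + ∑ x ∈ (MI.erase m).filter (fun x => x ∈ nb m), linLabILo (PL' x) (PH' x) (P1L' x) (P1H' x) ed en hn hd (z x - z m) (w x) i

/-- UPPER integer bound of `Σ·(nashVecLab …) i` (same data). [folklore] -/
def nashIHi (M MI : Finset ι) (nb : ι → Finset ι) (m : ι) (i : Fin 3) (z w : ι → Fin 3 → ℤ) (D ed en hn hd P0L P0H : ℤ)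
    (PL PH P1L P1H PL' PH' P1L' P1H' : ι → ℤ) : ℤ :=
  leadIHi P0L P0H D ed hn hd (z m) i
    - (if m ∈ MI then ∑ m' ∈ (M.erase m).filter (fun m' => m' ∈ nb m),
        linLabILo (PL m') (PH m') (P1L m') (P1H m') ed en hn hd (z m - z m') (w m) i else 0)
    + ∑ x ∈ (MI.erase m).filter (fun x => x ∈ nb m), linLabIHi (PL' x) (PH' x) (P1L' x) (P1H' x) ed en hn hd (z x - z m) (w x) i

variable {S D ed en hn hd P0L P0H : ℤ} {G : Matrix (Fin 3) (Fin 3) ℝ} {ε : ℝ} {M MI : Finset ι} {nb : ι → Finset ι} {m : ι}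
  {i : Fin 3} {z w : ι → Fin 3 → ℤ} {a ω : ι → Fin 3 → ℝ} {PL PH P1L P1H PL' PH' P1L' P1H' : ι → ℤ}

/-- ★ THE INTEGER NASH BOX: `nashILo ≤ Σ·(nashVecLab G M MI a ω nb m) i ≤ nashIHi`, `Σ = S·D·ed·hd²`, from the near-identity box,
`a x = (hn/hd)·z x`, `ω x = w x / D`, and the class readings of `ψ`, `ψ′` at every pair's `g(a − a', a − a')`. [folklore] -/
theorem nashI_mem (hG : ∀ i j, |G i j - (if i = j then 1 else 0)| ≤ ε) (hε : ε = (en : ℝ) / (ed : ℝ)) (hed : 0 < ed)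
    (hD : 0 < D) (hhd : 0 < hd) (ha : ∀ x j, a x j = (hn : ℝ) / (hd : ℝ) * (z x j : ℝ)) (hω : ∀ x j, ω x j = (w x j : ℝ) / (D : ℝ))
    (h0L : (P0L : ℝ) ≤ S * psiT (gram G (a m) (a m))) (h0H : S * psiT (gram G (a m) (a m)) ≤ (P0H : ℝ))
    (hown : ∀ m' ∈ (M.erase m).filter (fun m' => m' ∈ nb m),
      (PL m' : ℝ) ≤ S * psiT (gram G (a m - a m') (a m - a m')) ∧ S * psiT (gram G (a m - a m') (a m - a m')) ≤ (PH m' : ℝ)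
        ∧ (P1L m' : ℝ) ≤ S * psiT1 (gram G (a m - a m') (a m - a m'))
        ∧ S * psiT1 (gram G (a m - a m') (a m - a m')) ≤ (P1H m' : ℝ))
    (hnbr : ∀ x ∈ (MI.erase m).filter (fun x => x ∈ nb m),
      (PL' x : ℝ) ≤ S * psiT (gram G (a x - a m) (a x - a m)) ∧ S * psiT (gram G (a x - a m) (a x - a m)) ≤ (PH' x : ℝ)
        ∧ (P1L' x : ℝ) ≤ S * psiT1 (gram G (a x - a m) (a x - a m))
        ∧ S * psiT1 (gram G (a x - a m) (a x - a m)) ≤ (P1H' x : ℝ)) :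
    ((nashILo M MI nb m i z w D ed en hn hd P0L P0H PL PH P1L P1H PL' PH' P1L' P1H' : ℤ) : ℝ)
        ≤ ((S * D * ed * hd ^ 2 : ℤ) : ℝ) * nashVecLab G M MI a ω nb m i
      ∧ ((S * D * ed * hd ^ 2 : ℤ) : ℝ) * nashVecLab G M MI a ω nb m i
        ≤ ((nashIHi M MI nb m i z w D ed en hn hd P0L P0H PL PH P1L P1H PL' PH' P1L' P1H' : ℤ) : ℝ) := by
  obtain ⟨L1, L2⟩ := leadI_mem (S := S) (D := D) (ed := ed) (i := i) hhd (ha m) h0L h0H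
  -- label differences are the scaled integer differences
  have hsub : ∀ x y : ι, ∀ j, (a x - a y) j = (hn : ℝ) / (hd : ℝ) * (((z x - z y) j : ℤ) : ℝ) := by
    intro x y j; simp only [Pi.sub_apply, ha]; push_cast; ring
  have A : ∀ m' ∈ (M.erase m).filter (fun m' => m' ∈ nb m),
      ((linLabILo (PL m') (PH m') (P1L m') (P1H m') ed en hn hd (z m - z m') (w m) i : ℤ) : ℝ)
          ≤ ((S * D * ed * hd ^ 2 : ℤ) : ℝ) * linLab G (a m - a m') (ω m) i
        ∧ ((S * D * ed * hd ^ 2 : ℤ) : ℝ) * linLab G (a m - a m') (ω m) i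
          ≤ ((linLabIHi (PL m') (PH m') (P1L m') (P1H m') ed en hn hd (z m - z m') (w m) i : ℤ) : ℝ) := by
    intro m' hm'
    obtain ⟨p1, p2, p3, p4⟩ := hown m' hm'
    exact linLabI_mem hG hε hed hD hhd (hsub m m') (hω m) p1 p2 p3 p4
  have B : ∀ x ∈ (MI.erase m).filter (fun x => x ∈ nb m),
      ((linLabILo (PL' x) (PH' x) (P1L' x) (P1H' x) ed en hn hd (z x - z m) (w x) i : ℤ) : ℝ)
          ≤ ((S * D * ed * hd ^ 2 : ℤ) : ℝ) * linLab G (a x - a m) (ω x) i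
        ∧ ((S * D * ed * hd ^ 2 : ℤ) : ℝ) * linLab G (a x - a m) (ω x) i
          ≤ ((linLabIHi (PL' x) (PH' x) (P1L' x) (P1H' x) ed en hn hd (z x - z m) (w x) i : ℤ) : ℝ) := by
    intro x hx
    obtain ⟨p1, p2, p3, p4⟩ := hnbr x hx
    exact linLabI_mem hG hε hed hD hhd (hsub x m) (hω x) p1 p2 p3 p4
  have SA1 := Summit.AtomisticToContinuum.Crystallization.Theorems.FrustratedLawDichotomyCellArithGram.finsetSum_readings_le
    (S * D * ed * hd ^ 2) _ _ _ (fun m' hm' => (A m' hm').1)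
  have SA2 := Summit.AtomisticToContinuum.Crystallization.Theorems.FrustratedLawDichotomyCellArithGram.le_finsetSum_readings
    (S * D * ed * hd ^ 2) _ _ _ (fun m' hm' => (A m' hm').2)
  have SB1 := Summit.AtomisticToContinuum.Crystallization.Theorems.FrustratedLawDichotomyCellArithGram.finsetSum_readings_le
    (S * D * ed * hd ^ 2) _ _ _ (fun x hx => (B x hx).1)
  have SB2 := Summit.AtomisticToContinuum.Crystallization.Theorems.FrustratedLawDichotomyCellArithGram.le_finsetSum_readings
    (S * D * ed * hd ^ 2) _ _ _ (fun x hx => (B x hx).2)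
  have e : nashVecLab G M MI a ω nb m i = (psiT (gram G (a m) (a m)) • a m) i
      - (if m ∈ MI then ∑ m' ∈ (M.erase m).filter (fun m' => m' ∈ nb m), linLab G (a m - a m') (ω m) i else 0)
      + ∑ x ∈ (MI.erase m).filter (fun x => x ∈ nb m), linLab G (a x - a m) (ω x) i := by
    unfold nashVecLab
    by_cases h : m ∈ MI
    · simp [h, Finset.sum_apply]; ring
    · simp [h, Finset.sum_apply]
  rw [e]
  unfold nashILo nashIHi
  by_cases hMI : m ∈ MI
  · simp only [hMI, if_true]
    push_cast at SA1 SA2 SB1 SB2 L1 L2 ⊢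
    constructor <;> nlinarith [SA1, SA2, SB1, SB2, L1, L2]
  · simp only [hMI, if_false]
    push_cast at SB1 SB2 L1 L2 ⊢
    constructor <;> nlinarith [SB1, SB2, L1, L2]

end Assembly

end Summit.AtomisticToContinuum.Crystallization.Theorems.FrustratedLawDichotomyCellArithNashInt
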